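import Summits.CriticalPhenomena.Ising3DConformalLimit.Theorems.PerfectScreeningGaussianLimitNotScreenedHalfOneReduction
import HarnessLib

/-!
# Crux `GaussianLimitNotScreened` (stmt-CriticalPhenomena-13886), line `free-regular-variation-dcp-window`:
# how much of the window ONE axial capacity exponent buys (bookkeeping stub P2 of lead c5)

THEOREM-ONLY file (no definitions, no named facts). The crux is split (glue landed, p137467) into three leaves:
(β) no non-degenerate Möbius-covariant GAUSSIAN pointwise limit of `criticalCorr 3` with `1/2 < Δ < 3/4`, (γ) none at
the corner `Δ = 3/4`, (α) at `Δ = 1/2` the renormalisation is canonical (`¬ ρ(1/m)²/m → ∞`). This file records,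
kernel-checked, exactly how much of (β) and (α) the sister crux stmt-CriticalPhenomena-13885's registered open stub
`stub_isingCapacityAxial` (`∃ s ∈ (0,2)`, axial Ising capacity at `s`) buys:

* `stub_windowOfAxialCapacityAt` (registered bookkeeping stub P2 of the crux) — the axial Ising capacity AT one
  exponent `s > 0` forbids Gaussian non-degenerate Möbius limits of `criticalCorr 3` with `Δ < (3 − s)/2`: the landed
  one-exponent engine `twoCurrentMeet_lower_of_capacityAt` (fat spread cluster of dimension `s`, which exists only for
  `s < 3 − 2Δ`, × capacity × Griffiths × depletion bound) at the collinear axial quadruple `0, e₀, 2e₀, 3e₀`, whose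
  screened pair is axial, gives a uniform two-current meeting lower bound `P² ≥ κ > 0`, and Aizenman's criterion
  `hasNontrivialU4_of_twoCurrentMeet_lower` turns it into `U₄^S < 0` at that quadruple;
* `noGaussianWindowLimit_of_isingCapacityAxialAll` — leaf (β) VERBATIM from the axial capacity at EVERY `s > 3/2`
  (choose `s` strictly between `3/2` and `3 − 2Δ > 3/2`);
* `amplitudeAtHalf_of_isingCapacityAxialAt` — leaf (α) VERBATIM from the axial capacity at one `s < 2`
  (`Δ = 1/2 < (3 − s)/2`; the conclusion holds by vacuity, the limit not being Gaussian).

So 13885's stub pays (α) and pays (β) only on `(1/2, (3 − s)/2)`; the whole window needs every `s > 3/2`.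
Conditional theorems: they credit nothing by themselves.

References: M. Aizenman, Comm. Math. Phys. 86 (1982) §1 [Aizenman1982]; M. Aizenman, H. Duminil-Copin, Ann. of
Math. 194 (2021), eq. (3.11), Lemma 4.4, App. A Lemma A.1 [AizenmanDuminilCopinAnnals2021].
-/

noncomputable section

namespace Summit.CriticalPhenomena.Ising3DConformalLimit.Cruxes.GaussianLimitNotScreened.FreeRegularVariationDcpWindow

open Filter Topology
open Literature.Probability.LatticeModels
open Summit.CriticalPhenomena.Ising3DConformalLimit.Cruxes.IsingEuclidUpgradeR4NonGaussian.FreeCovarianceDeltaDichotomy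
  (lat boxG ScaleCovariantOn hasNontrivialU4_of_twoCurrentMeet_lower)
open Summit.CriticalPhenomena.Ising3DConformalLimit.Cruxes.GaussianLimitNotScreened.KaramataAmplitudeBlindMerging
  (IsSpreadDefect defectG scaleCovariantOn_of_isMoebiusCovariant)
open Summit.CriticalPhenomena.Ising3DConformalLimit.Cruxes.CoulombImpliesNontrivial.MergingIsExpectedScreening
  (twoCurrentMeet_lower_of_capacityAt)

/-- The collinear axial reference quadruple `0, e₀, 2e₀, 3e₀` of `ℝ³` is non-coincident. [folklore] -/
private theorem axialQuadruple_mem_nonCoincident :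
    (fun i : Fin 4 => ((i : ℕ) : ℝ) • EuclideanSpace.single (0 : Fin 3) (1:ℝ)) ∈ NonCoincident 3 4 := by
  intro i j hij
  have he : (EuclideanSpace.single (0 : Fin 3) (1:ℝ)) ≠ 0 := by
    intro h
    have := congrArg (fun v : EuclideanSpace ℝ (Fin 3) => v 0) h
    simp at this
  have h := smul_left_injective ℝ he hij
  have h' : (i : ℕ) = (j : ℕ) := by exact_mod_cast h
  exact Fin.ext h'

/-- The screened pair `[2e₀/δ], [3e₀/δ]` of the axial quadruple is axial: both lattice approximations vanish off
the first coordinate axis. [folklore] -/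
private theorem axialQuadruple_lat_axial (δ : ℝ) (j : Fin 3) (hj : j ≠ 0) :
    lat δ (fun i : Fin 4 => ((i : ℕ) : ℝ) • EuclideanSpace.single (0 : Fin 3) (1:ℝ)) 3 j =
      lat δ (fun i : Fin 4 => ((i : ℕ) : ℝ) • EuclideanSpace.single (0 : Fin 3) (1:ℝ)) 2 j := by
  fin_cases j
  · exact absurd rfl hj
  · simp [lat, latticeApprox_apply]
  · simp [lat, latticeApprox_apply]

/-- **Registered bookkeeping stub P2 `stub_windowOfAxialCapacityAt` — HOW MUCH OF THE WINDOW ONE AXIAL CAPACITY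
EXPONENT BUYS.** The axial Ising capacity AT a single exponent `s > 0` (crux stmt-CriticalPhenomena-13885's
registered `stub_isingCapacityAxial` is `∃ s < 2, …` of exactly this shape) forbids Gaussian non-degenerate Möbius
limits of `criticalCorr 3` with `Δ < (3 − s)/2`: Möbius covariance gives scale covariance on non-coincident
configurations (`scaleCovariantOn_of_isMoebiusCovariant`); `Δ < (3 − s)/2` is `s < 3 − 2Δ`, so the landed
one-exponent engine `twoCurrentMeet_lower_of_capacityAt` applies at the axial quadruple `0, e₀, 2e₀, 3e₀` and yields
`P² ≥ κ > 0` for small `δ` and large `L`; Aizenman's criterion `hasNontrivialU4_of_twoCurrentMeet_lower` concludes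
`U₄ ≢ 0`. [cite: Aizenman1982, §1] [cite: AizenmanDuminilCopinAnnals2021, eq. (3.11) and App. A Lemma A.1] -/
theorem stub_windowOfAxialCapacityAt :
    ∀ s : ℝ, 0 < s →
      (∀ K lam nu : ℝ, 0 < K → 0 < lam → 0 < nu →
        ∃ c' : ℝ, 0 < c' ∧ c' ≤ 1 ∧ ∃ R₀ : ℝ, ∀ c e : Site 3, (∀ j : Fin 3, j ≠ 0 → e j = c j) →
          R₀ ≤ ‖c - e‖ → ∀ᶠ L : ℕ in atTop, ∀ C : Finset (Site 3), c ∉ C → e ∉ C →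
            IsSpreadDefect s K lam nu c e C → defectG L C c e ≤ (1 - c') * boxG L c e) →
      ∀ (ρ : ℝ → ℝ) (Δ : ℝ) (S : CorrFamily 3), (∀ δ ∈ Set.Ioc (0:ℝ) 1, 0 < ρ δ) →
        HasPointwiseScalingLimit (criticalCorr 3) ρ S → IsNondegenerateTwoPoint S →
        IsMoebiusCovariant Δ S → Δ < (3 - s) / 2 → HasNontrivialU4 S := by
  intro s hs₀ hcap ρ Δ S hρ hlim hnd hMo hΔ
  have hcov : ScaleCovariantOn Δ S := scaleCovariantOn_of_isMoebiusCovariant hMo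
  have hsΔ : s < 3 - 2 * Δ := by linarith
  obtain ⟨κ, hκ, hev⟩ :=
    twoCurrentMeet_lower_of_capacityAt hs₀ hcap hρ hlim hnd hcov hsΔ axialQuadruple_mem_nonCoincident
      axialQuadruple_lat_axial
  exact hasNontrivialU4_of_twoCurrentMeet_lower hlim hnd axialQuadruple_mem_nonCoincident hκ hev

/-- **Leaf (β) VERBATIM from the axial Ising capacity at EVERY exponent `s > 3/2`.** Given `1/2 < Δ < 3/4`, the
exponent `s := (3/2 + (3 − 2Δ))/2` lies strictly between `3/2` and `3 − 2Δ` (as `3 − 2Δ > 3/2`), so the capacity at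
that `s` and `stub_windowOfAxialCapacityAt` (`Δ < (3 − s)/2 ⟺ s < 3 − 2Δ`) give `U₄ ≢ 0`. The hypothesis is the
axial weakening of the karamata line's `stub_isingCapacity`. [cite: AizenmanDuminilCopinAnnals2021, App. A Lemma A.1] -/
theorem noGaussianWindowLimit_of_isingCapacityAxialAll
    (hcap : ∀ s : ℝ, 3 / 2 < s → ∀ K lam nu : ℝ, 0 < K → 0 < lam → 0 < nu →
      ∃ c' : ℝ, 0 < c' ∧ c' ≤ 1 ∧ ∃ R₀ : ℝ, ∀ c e : Site 3, (∀ j : Fin 3, j ≠ 0 → e j = c j) →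
        R₀ ≤ ‖c - e‖ → ∀ᶠ L : ℕ in atTop, ∀ C : Finset (Site 3), c ∉ C → e ∉ C →
          IsSpreadDefect s K lam nu c e C → defectG L C c e ≤ (1 - c') * boxG L c e) :
    ∀ (ρ : ℝ → ℝ) (Δ : ℝ) (S : CorrFamily 3), (∀ δ ∈ Set.Ioc (0:ℝ) 1, 0 < ρ δ) →
      HasPointwiseScalingLimit (criticalCorr 3) ρ S → IsNondegenerateTwoPoint S →
      IsMoebiusCovariant Δ S → 1 / 2 < Δ → Δ < 3 / 4 → HasNontrivialU4 S := by
  intro ρ Δ S hρ hlim hnd hMo _ hlt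
  set s : ℝ := (3 / 2 + (3 - 2 * Δ)) / 2 with hs
  have hs₁ : 3 / 2 < s := by rw [hs]; linarith
  have hs₂ : Δ < (3 - s) / 2 := by rw [hs]; linarith
  exact stub_windowOfAxialCapacityAt s (by linarith) (hcap s hs₁) ρ Δ S hρ hlim hnd hMo hs₂

/-- **Leaf (α) VERBATIM from the axial Ising capacity at ONE exponent `s < 2`.** At `Δ = 1/2` we have
`(3 − s)/2 > 1/2 = Δ`, so `stub_windowOfAxialCapacityAt` makes every non-degenerate Möbius limit with `Δ = 1/2`
non-Gaussian, and (α) — a statement about GAUSSIAN such limits — holds by contradiction with `¬ HasNontrivialU4 S`.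
(This is `SingleLayerLinearRegression.amplitudeAtHalf_of_isingCapacityAxial'` with the exponent exposed.)
[cite: Aizenman1982, §1] -/
theorem amplitudeAtHalf_of_isingCapacityAxialAt {s : ℝ} (hs₀ : 0 < s) (hs₂ : s < 2)
    (hcap : ∀ K lam nu : ℝ, 0 < K → 0 < lam → 0 < nu →
      ∃ c' : ℝ, 0 < c' ∧ c' ≤ 1 ∧ ∃ R₀ : ℝ, ∀ c e : Site 3, (∀ j : Fin 3, j ≠ 0 → e j = c j) →
        R₀ ≤ ‖c - e‖ → ∀ᶠ L : ℕ in atTop, ∀ C : Finset (Site 3), c ∉ C → e ∉ C →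
          IsSpreadDefect s K lam nu c e C → defectG L C c e ≤ (1 - c') * boxG L c e) :
    ∀ (ρ : ℝ → ℝ) (S : CorrFamily 3), (∀ δ ∈ Set.Ioc (0:ℝ) 1, 0 < ρ δ) →
      HasPointwiseScalingLimit (criticalCorr 3) ρ S → IsNondegenerateTwoPoint S →
      IsMoebiusCovariant (1/2) S → ¬ HasNontrivialU4 S →
      ¬ Tendsto (fun m : ℕ => ρ (1 / m) ^ 2 / m) atTop atTop :=
  fun ρ S hρ hlim hnd hMo hU4 _ =>
    hU4 (stub_windowOfAxialCapacityAt s hs₀ hcap ρ (1/2) S hρ hlim hnd hMo (by linarith))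

/-! ## Leaf (β) audit (lead c5 wave)
Tree theorems under `Theorems/` (2026-08-17) concluding `HasNontrivialU4 S` for limits of `criticalCorr 3` with
`Δ ∈ (1/2, 3/4)` or any `Δ`, with the OPEN hypothesis each carries: `hasNontrivialU4_of_twoCurrentMeet_lower`,
`meetingRobustness_iff_hasNontrivialU4` (FatStep: lattice two-current meeting bound = 0636's thin step; any `Δ` /
`Δ < 3/4`); `hasNontrivialU4_of_lt_threeQuarters_of_capacity` (p102368: karamata `stub_isingCapacity`, all `s > 3/2`;
`Δ < 3/4`); `stub_windowOfAxialCapacityAt`, `noGaussianWindowLimit_of_isingCapacityAxialAll` (this file: axial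
capacity at one `s` / every `s > 3/2`); `noGaussianLimitBelowThreshold_of_interlacing`, `noGaussianWindowLimit_below…`,
`…_of_interlacing_of_upperWindow`, `hasNontrivialU4_of_interlacing_of_window/…gaussianWindow/…conditionalEta` (item
15702 `Interlacing`; only `2Δ < log₂(1+√2)`, else + upper window / item 15703 / conditional `η`);
`hasNontrivialU4_of_tetraBound_io`, `farMerging_gives_U4` (JoinForcesU4: lattice far-merging bound; any `Δ`). None is
hypothesis-free. NEAREST PAYER: item stmt-CriticalPhenomena-0636 `IsingEuclidUpgradeR4NonGaussian` (no `Δ`: implies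
(β) outright, `noGaussianWindowLimit_of_r4NonGaussian`; ledger: status open, attempts 28, leased) — stub-blocked. -/

end Summit.CriticalPhenomena.Ising3DConformalLimit.Cruxes.GaussianLimitNotScreened.FreeRegularVariationDcpWindow

end
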